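import Literature.MathematicalPhysics.QuantumFieldTheory.Balaban1983to89.B8Ineq132Rec

/-!
# `Balaban1983to89.B8Ineq130FaceRec` — [Balaban1985RegularSpaces] Sect. F (1.130)∕(1.133) p. 99, FACE-LEVEL EDITION FOR THE RECORD TOWER: the bound for a bond whose
# two endpoints lie in ONE centred block of level `m` of the (1.15)-tower — «Applying Lemma 1 many times, as in the proof of (1.65), (1.66)» PER BOND instead of per depth

statement-level skeleton of published theorems with citation tags; proofs where landed; nothing here is a claim about the Yang–Mills mass gap

CITATION HEADER.  [6] = T. Bałaban, *Spaces of regular gauge field configurations on a lattice and gauge fixing conditions*, Commun. Math. Phys. **99** (1985) 75–102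
[Balaban1985RegularSpaces]: Lemma 1 (1.23)–(1.25) p. 79, (1.15) p. 78, Sect. F pp. 98–99: *«Applying Lemma 1 many times, as in the proof of (1.65), (1.66), we get
|Ū₀′ʲ(x,x′) − 1| < 8d²L²(L^{−2(k−j−1)} + … + L^{−2} + 1)α₀ + (M + 4R₁M₁)dL²α₀ … (1.130)»*, (1.133) p. 99, (1.135) p. 99; [3] = [Balaban1985Averaging] (166)–(167) p. 44;
[I] = [Balaban1987RG1] (0.3)–(0.4) pp. 252–253 (centred blocks, the averaging of record).
Cell `pub-ymgap` (HUMAN RULING D-0062), seat `pub-ymgap-dag-n07-w3` g14 (WIDTH SEAT 3 on N07; junction owner of the K0-road φ-junction; INTENT-32, cell bus 2026-08-30 04:45Z).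
`--kind proof --supports stmt-QuantumFields-20541` (K0⁷; count-neutral; no definition).  REUSED BY NAME: dag-n05-d's `B8Ineq130Rec.{tlo, thi, fl, fl_mem, fl_add_e, inBlock_fl,
smul_mem, pair_mem, step_interior, step_cross, agree_level, two_mul_le_of_C0}`, `B8Ineq128Rec.{ineq128_global, gaugeFix_global, C0_mul_le_of_C0Z}`, `B8Ineq133Rec.cutFixedZ`,
`B8Eq119TwistedAxialRec.{flmZ, fl_eq_flmZ_one, iterate_fl_eq_flmZ}`, `B8Ineq132Rec.pdevOn_lt_of_inAk_box`; engine `B8Ineq130.{aLev, descent_sum_eq, geom_sum_le, aLev_mul_sq_le}`.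

WHY (the (σ1) letter `δ_W` of the K0-road junction, dag-n07-e g32 ⚑ LOCATED-σ1-FACES, cell bus 2026-08-30 04:35Z).  The tree's (1.130)∕(1.133) (`B8Ineq130Rec.descent`,
`B8Ineq133Rec.ineq133` (v)) bound `|Ū₀″^{(k−n)}(b) − 1|` UNIFORMLY over the bonds of the depth-`n` cube by `B_top + Σ_{m<n} 4d²L²a_{m+1} < 6dL²Mα₀`: a bound that does not decay with the
depth, because a bond CROSSING between two blocks inherits the coarse bond's bound (Lemma 1, (1.24)), and at the top the global axial gauge gives `(M + 4R₁M₁)dL²α₀`.  The same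
induction read PER BOND gives the geometric structure the junction's oscillation rows need ([3] (166)–(167)): a bond of the depth-`n` cube whose endpoints lie in ONE centred block of
level `m + 1` (`flmZ L (m+1) x = flmZ L (m+1) (x + e_ν)`) crosses at most `m` consecutive block boundaries before it becomes interior, so
`|Ū^{(k−n)}(b) − 1| ≤ Σ_{i<m} 4d²L²·a(n−i) + 2ds·a(n−m)` — NO top data (no centre `y`, no global axial gauge, no `M`).  At the fine level with `a_n = 2α₀L²L^{−2n}` this is
`≤ (9d² + 4ds)·α₀·(L^{m+1}∕L^k)²`: the hierarchical axial gauge jumps by `O(α₀)` only across TOP faces and by `O(α₀L^{2(m+1−k)})` across a level-`m` face.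

WHAT IS PROVED (sorry-free; axioms standard).
§1 ★★★ `descent_face` — the per-bond descent on the centred tower (hypotheses = `B8Ineq130Rec.descent`'s tower rows WITHOUT the top: `U1` levels, per-depth plaquette letters `a n`,
   (1.15) centred block contours, `a_nL² ≤ 1∕(6(d+1)(d+2))`, `Σ_{m<k} 4d²L²a_{m+1} ≤ 1∕6`).
§2 ★★ `ineq130_face_local` — (1.7) on the finest centred cube `□̃` only + `AvgClosedZ` + (1.15) displayed ⇒ the face-level (1.130) at every depth (clamp + [3] Prop. 2 for the record,
   `B8Ineq128Rec.ineq128_global`, exactly as `B8Ineq128Rec.ineq130_local`).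
§3 ★★ `ineq130_face_fixed` — FOR EVERY ORBIT: the (1.15)-gauge `localGaugeZ` of `B8Eq115GaugeFixingRec` supplies (1.15) (as in `B8Ineq128Rec.ineq130_fixed`, top rows not needed).
§4 (private `eight_mul_geom_le`: `8qΣ_{i<m}qⁱ ≤ 9qᵐ`, `q = L² ≥ 9`), ★★ `faceSum_aLev_le` (the closed form `(9d² + 4ds)α₀(L^{m+1}∕L^k)²`),
   ★★★ `norm_cutFixedZ_sub_one_le_face` — `U₀″ = cutFixedZ …` ([6] p. 99): every FINE bond of `□̃` inside one centred level-`(m+1)` block, `m + 1 ≤ k`, obeys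
   `|U₀″(b) − 1| ≤ (9d² + 4ds)·α₀·(L^{m+1})²·(L^k)^{−2}` — vs the level-free `6dL²Mα₀` of `B8Prop6CubeMemberRec.norm_cutFixedZ_sub_one_le`.
HONEST FRAMING: count-neutral Literature helper; a refinement of the tree's own descent bookkeeping (Lemma 1 applied per bond); NO inequality of [6]∕[3]∕[I] beyond Lemma 1's iteration
is asserted; `HThm4RecSym152PhiEG` ∕ `HThm4Rec*` UNDISCHARGED; N05 ∕ N07 NOT discharged; K0⁷ ∕ K1⁹ NOT closed; counts unmoved; one finite 𝕋⁴ programme at fixed ε — R4 closes the conditional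
finite-𝕋⁴ rung `BalabanLadder.UV` only; the YM mass gap (Clay) is NOT proved by any of this; nothing continuum ∕ ℝ⁴ ∕ OS.  No `def`, no `instance`, no `notation`, no `sorry`.
-/

set_option autoImplicit false

noncomputable section

open scoped BigOperators
open NormedSpace Finset

namespace Literature.MathematicalPhysics.QuantumFieldTheory.Balaban1983to89.B8Ineq130FaceRec

open B7Prop1Explicit MatrixLog BlockAveragingZd B8Lemma1NonAbelianRecLoops B8Lemma1NonAbelianRec B8Ineq130Rec B8Eq115GaugeFixingRec B8Ineq128Rec
  B8Ineq133Rec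
open B7Prop2Explicit (rescale rescale_apply pdev C0 C0_pos c2' le_pdev)
open B7Prop2Rec (AvgClosedZ C0Z C0Z_pos avgIterZ_mem)
open B7Prop1Local (InBox AgreeOn clampCfg clampCfg_agree clampCfg_mem pdev_clampCfg_le pdevOn)
open B8Lemma1NonAbelian (e_nonneg)
open B8Ineq129 (le_of_add_e_le plaqSmall_of_pdev)
open B8Ineq130 (aLev inBox_of_le axialFn_congr pow_inv_sq_le_one descent_sum_eq geom_sum_le aLev_mul_sq_le)
open B8Eq115GaugeFixing (gaugeAct_mem_of gaugeAct_agree pdevOn_gaugeAct)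
open B8Eq119TwistedAxialRec (flmZ fl_eq_flmZ_one iterate_fl_eq_flmZ)
open B8Ineq133 (cutCfg cutCfg_agree cutCfg_eq_one)
open B8Ineq132 (InAk)
open B8Ineq132Rec (pdevOn_lt_of_inAk_box)

-- `Site` alone would resolve to the torus sites of `Setup.lean`; re-export the `ℤᵈ` sites of `B7Prop1Explicit`.
export B7Prop1Explicit (Site)

variable {d : ℕ}

/-! ## §0 Arithmetic of the face sums -/

/-- A sub-sum of the descent budget: `Σ_{i<m} c·a(n−i) ≤ Σ_{j<k} c·a(j+1)` for `m ≤ n ≤ k` and non-negative terms (reindex `j := n − 1 − i`). [folklore] -/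
private theorem sum_range_sub_le {a : ℕ → ℝ} {c : ℝ} {k n m : ℕ} (hn : n ≤ k) (hm : m ≤ n)
    (hnn : ∀ j, 1 ≤ j → j ≤ k → 0 ≤ c * a j) :
    ∑ i ∈ Finset.range m, c * a (n - i) ≤ ∑ j ∈ Finset.range k, c * a (j + 1) := by
  have hinj : Set.InjOn (fun i => n - 1 - i) (Finset.range m : Set ℕ) := by
    intro i hi i' hi' h
    simp only [Finset.coe_range, Set.mem_Iio] at hi hi'
    dsimp only at h
    omega
  have heq : ∑ i ∈ Finset.range m, c * a (n - i) = ∑ j ∈ (Finset.range m).image (fun i => n - 1 - i), c * a (j + 1) := by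
    rw [Finset.sum_image hinj]
    refine Finset.sum_congr rfl fun i hi => ?_
    have hi' := Finset.mem_range.mp hi
    congr 2
    omega
  rw [heq]
  refine Finset.sum_le_sum_of_subset_of_nonneg ?_ ?_
  · intro j hj
    obtain ⟨i, hi, rfl⟩ := Finset.mem_image.mp hj
    have := Finset.mem_range.mp hi
    exact Finset.mem_range.mpr (by omega)
  · intro j hj _
    have := Finset.mem_range.mp hj
    exact hnn (j + 1) (by omega) (by omega)

/-- The one-step centred floor and the level floors: `flmZ L (m+1) x = flmZ L m (fl L x)` (odd `L`; `(fl L)^[m+1] = (fl L)^[m] ∘ fl L`). [cite: Balaban1987RG1, (0.3) p.252 (bookkeeping)] -/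
theorem flmZ_succ_eq_flmZ_fl {L : ℕ} (hL : Odd L) (m : ℕ) (x : Site d) : flmZ L (m + 1) x = flmZ L m (fl L x) := by
  rw [← iterate_fl_eq_flmZ hL (m + 1) x, ← iterate_fl_eq_flmZ hL m (fl L x), Function.iterate_succ_apply]

/-! ## §1 The per-bond descent through the centred tower — no top data -/

section Descent

variable {𝔸 : Type*} [NormedRing 𝔸] [NormOneClass 𝔸] [NormedAlgebra ℂ 𝔸] [CompleteSpace 𝔸]

/-- ★★★ **THE FACE-LEVEL DESCENT (record average, centred tower), NO TOP DATA**: if every level `Ūʲ = avgIterZ L U j`, `j ≤ k`, is `U1`-valued, the level of depth `n ≥ 1` has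
plaquettes within `a_n` of `1` on its cube, (1.15) (centred block contours) holds between consecutive levels, `a_nL² ≤ 1∕(6(d+1)(d+2))` and `Σ_{m<k} 4d²L²a_{m+1} ≤ 1∕6`, then for
every depth `n ≤ k`, every `m` with `m + 1 ≤ n` and every bond `⟨x, x + e_ν⟩` of the depth-`n` cube whose endpoints lie in ONE centred block of level `m + 1`
(`flmZ L (m+1) x = flmZ L (m+1) (x + e_ν)`): `|Ū^{k−n}(x, x + e_ν) − 1| ≤ Σ_{i<m} 4d²L²·a(n−i) + 2ds·a(n−m)` — Lemma 1's interior half at the level where the bond becomes interior,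
its crossing half at the `m` levels below; the top bound of (1.129) never enters.
[cite: Balaban1985RegularSpaces, Lemma 1 (1.24)–(1.25) p.79, p.87 (proof of (1.65)), (1.130) p.99; Balaban1985Averaging, (166)–(167) p.44; Balaban1987RG1, (0.4) p.253] -/
theorem descent_face {L s : ℕ} (hL : L = 2 * s + 1) (hd : 1 ≤ d) (lo hi : Site d) (U : Site d → Fin d → 𝔸ˣ) (k : ℕ)
    (a : ℕ → ℝ)
    (hmem : ∀ j ≤ k, ∀ x μ, avgIterZ L U j x μ ∈ U1 𝔸)
    (hplaq : ∀ n, 1 ≤ n → n ≤ k →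
      B8Lemma1NonAbelian.PlaqSmall (avgIterZ L U (k - n)) (tlo L lo n) (thi L hi n) (a n))
    (h15 : ∀ n, n < k → ∀ z, tlo L lo n ≤ z → z ≤ thi L hi n → ∀ r : Fin d → Fin L,
      axialFn (avgIterZ L U (k - (n + 1))) ((L : ℤ) • z) ((L : ℤ) • z + offZ L r) = 1)
    (ha : ∀ n, 1 ≤ n → n ≤ k → 0 < a n ∧ a n * (L : ℝ) ^ 2 ≤ 1 / (6 * ((d : ℝ) + 1) * ((d : ℝ) + 2)))
    (htot : ∑ m ∈ Finset.range k, 4 * (d : ℝ) ^ 2 * (L : ℝ) ^ 2 * a (m + 1) ≤ 1 / 6) :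
    ∀ m n : ℕ, m + 1 ≤ n → n ≤ k → ∀ (x : Site d) (ν : Fin d), tlo L lo n ≤ x → x + e ν ≤ thi L hi n →
      flmZ L (m + 1) x = flmZ L (m + 1) (x + e ν) →
      ‖((avgIterZ L U (k - n) x ν : 𝔸ˣ) : 𝔸) - 1‖ ≤
        (∑ i ∈ Finset.range m, 4 * (d : ℝ) ^ 2 * (L : ℝ) ^ 2 * a (n - i)) + 2 * ((d : ℝ) * s) * a (n - m) := by
  have hLo : Odd L := ⟨s, hL⟩
  have hL1 : 1 ≤ L := by omega
  have hterm : ∀ j, 1 ≤ j → j ≤ k → 0 ≤ 4 * (d : ℝ) ^ 2 * (L : ℝ) ^ 2 * a j := fun j hj hjk => by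
    have := (ha j hj hjk).1; positivity
  -- `2ds·a ≤ 4d²L²·a`: the interior bound is dominated by one crossing term
  have hdL : ∀ j, 1 ≤ j → j ≤ k → 2 * ((d : ℝ) * s) * a j ≤ 4 * (d : ℝ) ^ 2 * (L : ℝ) ^ 2 * a j := fun j hj hjk => by
    have ha0 := (ha j hj hjk).1
    have hd1 : (1 : ℝ) ≤ d := by exact_mod_cast hd
    have hsL : (s : ℝ) ≤ L := by exact_mod_cast (show s ≤ L by omega)
    have hL1' : (1 : ℝ) ≤ L := by exact_mod_cast hL1
    have hds : (d : ℝ) * s ≤ d * L := mul_le_mul_of_nonneg_left hsL (by linarith)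
    have hdL1 : 1 ≤ (d : ℝ) * L := by nlinarith
    have hdL2 : (d : ℝ) * L ≤ ((d : ℝ) * L) ^ 2 := by nlinarith
    have h2 : 2 * ((d : ℝ) * s) ≤ 4 * (d : ℝ) ^ 2 * (L : ℝ) ^ 2 := by nlinarith
    exact mul_le_mul_of_nonneg_right h2 ha0.le
  intro m
  induction m with
  | zero =>
    -- both endpoints in one centred `L`-block: the interior half of Lemma 1 at depth `n`
    intro n hmn hn x ν hx hxν hfl
    obtain ⟨n', rfl⟩ : ∃ n', n = n' + 1 := ⟨n - 1, by omega⟩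
    simp only [Finset.range_zero, Finset.sum_empty, zero_add, Nat.sub_zero]
    rw [zero_add, ← fl_eq_flmZ_one, ← fl_eq_flmZ_one] at hfl
    have hxhi : x ≤ thi L hi (n' + 1) := le_of_add_e_le hxν
    obtain ⟨hz, hz'⟩ := fl_mem hL hx hxhi
    obtain ⟨r, hr⟩ := inBlock_fl hL x
    obtain ⟨r', hr'⟩ := inBlock_fl hL (x + e ν)
    rw [← hfl] at hr'
    obtain ⟨hlz, hlz'⟩ := smul_mem (L := L) hz hz'
    have hax := h15 n' (by omega) (fl L x) hz hz'
    exact step_interior hL (hmem (k - (n' + 1)) (by omega)) (hplaq (n' + 1) (by omega) hn) (ha (n' + 1) (by omega) hn).1.le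
      hlz hlz' hax x ν r r' hr hr' hx hxν
  | succ m ih =>
    intro n hmn hn x ν hx hxν hfl
    obtain ⟨n', rfl⟩ : ∃ n', n = n' + 1 := ⟨n - 1, by omega⟩
    have hn' : n' ≤ k := by omega
    have hxhi : x ≤ thi L hi (n' + 1) := le_of_add_e_le hxν
    have hxν' : tlo L lo (n' + 1) ≤ x + e ν := hx.trans (le_add_of_nonneg_right (e_nonneg ν))
    obtain ⟨hz, hz'⟩ := fl_mem hL hx hxhi
    obtain ⟨hw, hw'⟩ := fl_mem hL hxν' hxν
    obtain ⟨r, hr⟩ := inBlock_fl hL x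
    have hbx' := inBlock_fl hL (x + e ν)
    have hW := hmem (k - (n' + 1)) (by omega)
    have hP := hplaq (n' + 1) (by omega) hn
    obtain ⟨ha0, ha1⟩ := ha (n' + 1) (by omega) hn
    have hax := h15 n' (by omega) (fl L x) hz hz'
    -- the target, with its first crossing term split off: `Σ_{i<m+1} c·a(n−i) = c·a(n) + Σ_{i<m} c·a(n' − i)`
    have hsplit : ∑ i ∈ Finset.range (m + 1), 4 * (d : ℝ) ^ 2 * (L : ℝ) ^ 2 * a (n' + 1 - i) =
        (∑ i ∈ Finset.range m, 4 * (d : ℝ) ^ 2 * (L : ℝ) ^ 2 * a (n' - i)) + 4 * (d : ℝ) ^ 2 * (L : ℝ) ^ 2 * a (n' + 1) := by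
      rw [Finset.sum_range_succ']
      congr 1
      refine Finset.sum_congr rfl fun i hi => ?_
      congr 2
      omega
    have hlast : n' + 1 - (m + 1) = n' - m := by omega
    rw [hsplit, hlast]
    have hrest0 : 0 ≤ (∑ i ∈ Finset.range m, 4 * (d : ℝ) ^ 2 * (L : ℝ) ^ 2 * a (n' - i)) + 2 * ((d : ℝ) * s) * a (n' - m) := by
      refine add_nonneg (Finset.sum_nonneg fun i hi => ?_) ?_
      · have := Finset.mem_range.mp hi
        exact hterm _ (by omega) (by omega)
      · have := (ha (n' - m) (by omega) (by omega)).1; positivity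
    rcases fl_add_e hL1 x ν with hsame | hcross
    · -- interior already at depth `n`: `2ds·a(n) ≤ 4d²L²·a(n) ≤` the whole bound
      rw [hsame] at hbx'
      obtain ⟨r', hr'⟩ := hbx'
      obtain ⟨hlz, hlz'⟩ := smul_mem (L := L) hz hz'
      have hb := step_interior hL hW hP ha0.le hlz hlz' hax x ν r r' hr hr' hx hxν
      have h1 := hdL (n' + 1) (by omega) hn
      linarith
    · -- the bond crosses from `B(L·z)` to `B(L·(z + e_ν))`, `z = fl L x`: Lemma 1 on the pair, the coarse bond bounded by the induction hypothesis
      rw [hcross] at hbx' hw hw'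
      have hflz : flmZ L (m + 1) (fl L x) = flmZ L (m + 1) (fl L x + e ν) := by
        rw [← flmZ_succ_eq_flmZ_fl hLo, hfl, flmZ_succ_eq_flmZ_fl hLo, hcross]
      have hih := ih n' (by omega) hn' (fl L x) ν hz hw' hflz
      have hj : k - n' = k - (n' + 1) + 1 := by omega
      have havg : ‖((bavgZ L (avgIterZ L U (k - (n' + 1))) ((L : ℤ) • fl L x) ν : 𝔸ˣ) : 𝔸) - 1‖ ≤
          (∑ i ∈ Finset.range m, 4 * (d : ℝ) ^ 2 * (L : ℝ) ^ 2 * a (n' - i)) + 2 * ((d : ℝ) * s) * a (n' - m) := by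
        rwa [hj, avgIterZ_succ, rescale_apply] at hih
      -- the coarse bound is within Lemma 1's range: `≤ Σ_{j ≤ k} 4d²L²a_j ≤ 1∕6`
      have hB1 : (∑ i ∈ Finset.range m, 4 * (d : ℝ) ^ 2 * (L : ℝ) ^ 2 * a (n' - i)) + 2 * ((d : ℝ) * s) * a (n' - m) ≤ 1 / 6 := by
        have h1 := hdL (n' - m) (by omega) (by omega)
        have h2 : (∑ i ∈ Finset.range m, 4 * (d : ℝ) ^ 2 * (L : ℝ) ^ 2 * a (n' - i)) + 4 * (d : ℝ) ^ 2 * (L : ℝ) ^ 2 * a (n' - m) =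
            ∑ i ∈ Finset.range (m + 1), 4 * (d : ℝ) ^ 2 * (L : ℝ) ^ 2 * a (n' - i) := by
          rw [Finset.sum_range_succ]
        have h3 := sum_range_sub_le (a := a) (c := 4 * (d : ℝ) ^ 2 * (L : ℝ) ^ 2) hn' (show m + 1 ≤ n' by omega) hterm
        linarith
      have hpm := pair_mem (lo := lo) (hi := hi) hz hw'
      have hbx0 : InBlock L ((L : ℤ) • fl L x) x := ⟨r, hr⟩
      rw [smul_add] at hbx'
      have hb := step_cross hL hW (hP.mono hpm.1 hpm.2) hax (h15 n' (by omega) _ hw hw') havg ha0 ha1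
        hrest0 hB1 x ν (Or.inl hbx0) (Or.inr hbx')
      have h4 : 4 * (d : ℝ) ^ 2 * (a (n' + 1) * (L : ℝ) ^ 2) = 4 * (d : ℝ) ^ 2 * (L : ℝ) ^ 2 * a (n' + 1) := by ring
      linarith

end Descent

/-! ## §2 The face-level (1.130), local carrier ((1.7) on the finest cube only), RECORD AVERAGE -/

section Local

variable {𝔸 : Type*} [NormedRing 𝔸] [NormOneClass 𝔸] [NormedAlgebra ℂ 𝔸] [CompleteSpace 𝔸]

/-- The descent budget of (1.128): `a_n = 2α₀L²L^{−2n}` is Lemma-1-small (`C₀ᶻ(α₀L²) ≤ ⅓`) and `Σ_{m<k} 4d²L²a_{m+1} = 8d²L²(Σ L^{−2m})α₀ ≤ (32∕3)d²L²α₀ ≤ 1∕6` once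
`11d²L²α₀ ≤ 1∕6` (the first summand of (1.130)'s printed smallness). [cite: Balaban1985RegularSpaces, (1.128) p.98, (1.130) p.99, p.87 (1.65)] -/
theorem aLev_budget {L : ℕ} (hL : 2 ≤ L) {α₀ : ℝ} (hα : 0 < α₀) (hα3 : C0Z d * (α₀ * (L : ℝ) ^ 2) ≤ 1 / 3)
    (hsmall : 11 * (d : ℝ) ^ 2 * (L : ℝ) ^ 2 * α₀ ≤ 1 / 6) (k : ℕ) :
    (∀ n, 1 ≤ n → n ≤ k → 0 < aLev α₀ L n ∧ aLev α₀ L n * (L : ℝ) ^ 2 ≤ 1 / (6 * ((d : ℝ) + 1) * ((d : ℝ) + 2))) ∧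
    ∑ m ∈ Finset.range k, 4 * (d : ℝ) ^ 2 * (L : ℝ) ^ 2 * aLev α₀ L (m + 1) ≤ 1 / 6 := by
  have hL1 : 1 ≤ L := le_trans (by norm_num) hL
  have hLpos : (0 : ℝ) < L := by exact_mod_cast (lt_of_lt_of_le (by norm_num) hL)
  refine ⟨fun n hn _ => ⟨by unfold aLev; positivity,
    (aLev_mul_sq_le hL1 hα.le hn).trans (two_mul_le_of_C0 (by positivity) (C0_mul_le_of_C0Z (by positivity) hα3))⟩, ?_⟩
  rw [descent_sum_eq hL1]
  have hS := geom_sum_le hL k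
  have h8 : 0 ≤ 8 * (d : ℝ) ^ 2 * (L : ℝ) ^ 2 * α₀ := by positivity
  have := mul_le_mul_of_nonneg_left hS h8
  nlinarith

/-- ★★ **THE FACE-LEVEL (1.130), LOCAL CARRIER, RECORD AVERAGE**: `G` an `AvgClosedZ` gauge group, odd `L ≥ 3`, `d ≥ 1`, `U` `G`-valued with (1.7) on the unit plaquettes of the
finest centred cube `□̃ = [tlo k, thi k]` ONLY, `α₀L²` Prop.-1-small for the record, `11d²L²α₀ ≤ 1∕6`, and (1.15) (centred block contours) between all consecutive levels on the tower
DISPLAYED; then for every depth `n ≤ k`, `m + 1 ≤ n`, and every bond of `□̃^{(k−n)}` inside one centred level-`(m+1)` block: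
`|Ū^{k−n}(x, x+e_ν) − 1| ≤ Σ_{i<m} 4d²L²·a_{n−i} + 2ds·a_{n−m}`, `a_n = 2α₀L²L^{−2n}`.  Proof: clamp to `□̃`, (1.128) for the clamp (`B8Ineq128Rec.ineq128_global`), `descent_face`,
locality of the averages on the tower. [cite: Balaban1985RegularSpaces, (1.130) p.99, (1.128) p.98, (1.15) p.78, Lemma 1 p.79; Balaban1985Averaging, Prop. 2 p.26; Balaban1987RG1, (0.4) p.253] -/
theorem ineq130_face_local {L s : ℕ} (hLs : L = 2 * s + 1) (hL : 2 ≤ L) (hd : 1 ≤ d) {G : Subgroup 𝔸ˣ} (hG : AvgClosedZ d L G) (k : ℕ)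
    (U : Site d → Fin d → 𝔸ˣ) (hU : ∀ x κ, U x κ ∈ G) {α₀ : ℝ} (hα : 0 < α₀)
    (hα3 : C0Z d * (α₀ * (L : ℝ) ^ 2) ≤ 1 / 3) (hα2 : 2 * (α₀ * (L : ℝ) ^ 2) ≤ c2' d L)
    (lo hi : Site d) (hlohi : lo ≤ hi)
    (h17 : pdevOn (tlo L lo k) (thi L hi k) U < α₀ * (L : ℝ) ^ 2 * (((L : ℝ) ^ k)⁻¹) ^ 2)
    (h15 : ∀ n, n < k → ∀ z, tlo L lo n ≤ z → z ≤ thi L hi n → ∀ r : Fin d → Fin L,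
      axialFn (avgIterZ L U (k - (n + 1))) ((L : ℤ) • z) ((L : ℤ) • z + offZ L r) = 1)
    (hsmall : 11 * (d : ℝ) ^ 2 * (L : ℝ) ^ 2 * α₀ ≤ 1 / 6)
    {m n : ℕ} (hmn : m + 1 ≤ n) (hn : n ≤ k) (x : Site d) (ν : Fin d) (hx : tlo L lo n ≤ x) (hxν : x + e ν ≤ thi L hi n)
    (hfl : flmZ L (m + 1) x = flmZ L (m + 1) (x + e ν)) :
    ‖((avgIterZ L U (k - n) x ν : 𝔸ˣ) : 𝔸) - 1‖ ≤
      (∑ i ∈ Finset.range m, 4 * (d : ℝ) ^ 2 * (L : ℝ) ^ 2 * aLev α₀ L (n - i)) + 2 * ((d : ℝ) * s) * aLev α₀ L (n - m) := by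
  have hUU : ∀ x κ, U x κ ∈ U1 𝔸 := fun x κ => hG.le_U1 (hU x κ)
  have hkk : ∀ i, tlo L lo k i ≤ thi L hi k i := tlo_le_thi L hlohi k
  have hU' : ∀ x κ, clampCfg (tlo L lo k) (thi L hi k) U x κ ∈ G := clampCfg_mem hU
  have h17' : pdev (clampCfg (tlo L lo k) (thi L hi k) U) < α₀ * (L : ℝ) ^ 2 * (((L : ℝ) ^ k)⁻¹) ^ 2 :=
    (pdev_clampCfg_le hkk hUU).trans_lt h17
  have h128 := fun m hm => ineq128_global L hL hG k _ hU' hα hα3 hα2 h17' m hm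
  have hmemG := (h128 0 (Nat.zero_le k)).2
  have hmem : ∀ j ≤ k, ∀ x μ, avgIterZ L (clampCfg (tlo L lo k) (thi L hi k) U) j x μ ∈ U1 𝔸 := fun j hj x μ =>
    hG.le_U1 (hmemG j (by simpa using hj) x μ)
  have hA : ∀ j m, m + j = k → AgreeOn (tlo L lo m) (thi L hi m)
      (avgIterZ L (clampCfg (tlo L lo k) (thi L hi k) U) j) (avgIterZ L U j) := fun j m hmj =>
    agree_level hLs j m (by rw [hmj]; exact clampCfg_agree U)
  have h15' : ∀ n, n < k → ∀ z, tlo L lo n ≤ z → z ≤ thi L hi n → ∀ r : Fin d → Fin L,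
      axialFn (avgIterZ L (clampCfg (tlo L lo k) (thi L hi k) U) (k - (n + 1))) ((L : ℤ) • z)
        ((L : ℤ) • z + offZ L r) = 1 := by
    intro n hn z hz hz' r
    obtain ⟨h1, h2⟩ := block_mem hLs hz hz' r
    obtain ⟨h3, h4⟩ := smul_mem (L := L) hz hz'
    rw [axialFn_congr (hA (k - (n + 1)) (n + 1) (by omega)) _ _ (inBox_of_le h3 h4) (inBox_of_le h1 h2)]
    exact h15 n hn z hz hz' r
  obtain ⟨ha, htot⟩ := aLev_budget (d := d) hL hα hα3 hsmall k
  have hmain := descent_face hLs hd lo hi _ k (aLev α₀ L) hmem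
    (fun m hm1 hmk => plaqSmall_of_pdev (hmem _ (by omega)) (h128 m hmk).1.le _ _) h15' ha htot m n hmn hn x ν hx hxν hfl
  rwa [hA (k - n) n (by omega) x ν (inBox_of_le hx (le_of_add_e_le hxν))
    (inBox_of_le (hx.trans (le_add_of_nonneg_right (e_nonneg ν))) hxν)] at hmain

/-! ## §3 The face-level (1.130) FOR EVERY ORBIT (the (1.15)-gauge `localGaugeZ` of the record tower) -/

/-- ★★ **THE FACE-LEVEL (1.130) FOR EVERY ORBIT, LOCAL CARRIER, RECORD TOWER**: `G` `AvgClosedZ`, odd `L ≥ 3`, `d ≥ 1`, `U₀` `G`-valued, (1.7) on the unit plaquettes of the centred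
finest cube `□̃ = [tlo k, thi k]` ONLY, the Prop.-1 smallness and `11d²L²α₀ ≤ 1∕6`.  For `u := localGaugeZ L lo hi U₀ k y` (ANY centre `y` — the global axial gauge of the top is
irrelevant here) and `U₀′ := U₀^{u}`: for every depth `n ≤ k`, `m + 1 ≤ n`, and every bond of `□̃^{(k−n)}` inside one centred level-`(m+1)` block,
`|Ū₀′^{k−n}(x, x+e_ν) − 1| ≤ Σ_{i<m} 4d²L²·a_{n−i} + 2ds·a_{n−m}`, `a_n = 2α₀L²L^{−2n}`. [cite: Balaban1985RegularSpaces, (1.130) p.99, p.98, (1.15) p.78; Balaban1987RG1, (0.4) p.253] -/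
theorem ineq130_face_fixed {L s : ℕ} (hLs : L = 2 * s + 1) (hL : 2 ≤ L) (hd : 1 ≤ d) {G : Subgroup 𝔸ˣ} (hG : AvgClosedZ d L G) (k : ℕ)
    (U : Site d → Fin d → 𝔸ˣ) (hU : ∀ x κ, U x κ ∈ G) {α₀ : ℝ} (hα : 0 < α₀)
    (hα3 : C0Z d * (α₀ * (L : ℝ) ^ 2) ≤ 1 / 3) (hα2 : 2 * (α₀ * (L : ℝ) ^ 2) ≤ c2' d L)
    (lo hi : Site d) (hlohi : lo ≤ hi)
    (h17 : pdevOn (tlo L lo k) (thi L hi k) U < α₀ * (L : ℝ) ^ 2 * (((L : ℝ) ^ k)⁻¹) ^ 2)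
    (hsmall : 11 * (d : ℝ) ^ 2 * (L : ℝ) ^ 2 * α₀ ≤ 1 / 6) (y : Site d)
    {m n : ℕ} (hmn : m + 1 ≤ n) (hn : n ≤ k) (x : Site d) (ν : Fin d) (hx : tlo L lo n ≤ x) (hxν : x + e ν ≤ thi L hi n)
    (hfl : flmZ L (m + 1) x = flmZ L (m + 1) (x + e ν)) :
    ‖((avgIterZ L (gaugeAct (localGaugeZ L lo hi U k y) U) (k - n) x ν : 𝔸ˣ) : 𝔸) - 1‖ ≤
      (∑ i ∈ Finset.range m, 4 * (d : ℝ) ^ 2 * (L : ℝ) ^ 2 * aLev α₀ L (n - i)) + 2 * ((d : ℝ) * s) * aLev α₀ L (n - m) := by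
  have hUU : ∀ x κ, U x κ ∈ U1 𝔸 := fun x κ => hG.le_U1 (hU x κ)
  have hkk : ∀ i, tlo L lo k i ≤ thi L hi k i := tlo_le_thi L hlohi k
  set Uc := clampCfg (tlo L lo k) (thi L hi k) U with hUc
  have hUcG : ∀ x κ, Uc x κ ∈ G := clampCfg_mem hU
  have h17c : pdev Uc < α₀ * (L : ℝ) ^ 2 * (((L : ℝ) ^ k)⁻¹) ^ 2 := (pdev_clampCfg_le hkk hUU).trans_lt h17
  obtain ⟨huG, -, -, -, h15c, -⟩ := gaugeFix_global hLs hL hG k Uc hUcG hα hα3 hα2 h17c y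
  have huU : ∀ x, localGaugeZ L lo hi U k y x ∈ U1 𝔸 := fun x => hG.le_U1 (huG x)
  have hU' : ∀ x κ, gaugeAct (localGaugeZ L lo hi U k y) U x κ ∈ G := gaugeAct_mem_of hU huG
  have hA : ∀ j m, m + j = k → AgreeOn (tlo L lo m) (thi L hi m)
      (avgIterZ L (gaugeAct (localGaugeZ L lo hi U k y) Uc) j)
      (avgIterZ L (gaugeAct (localGaugeZ L lo hi U k y) U) j) := fun j m hmj =>
    agree_level hLs j m (by rw [hmj]; exact gaugeAct_agree (clampCfg_agree U) _)
  have h15' : ∀ n, n < k → ∀ z, tlo L lo n ≤ z → z ≤ thi L hi n → ∀ r : Fin d → Fin L,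
      axialFn (avgIterZ L (gaugeAct (localGaugeZ L lo hi U k y) U) (k - (n + 1))) ((L : ℤ) • z)
        ((L : ℤ) • z + offZ L r) = 1 := by
    intro n hn z hz hz' r
    obtain ⟨h1, h2⟩ := block_mem hLs hz hz' r
    obtain ⟨h3, h4⟩ := smul_mem (L := L) hz hz'
    rw [← axialFn_congr (hA (k - (n + 1)) (n + 1) (by omega)) _ _ (inBox_of_le h3 h4) (inBox_of_le h1 h2)]
    exact h15c n hn z r
  have h17' : pdevOn (tlo L lo k) (thi L hi k) (gaugeAct (localGaugeZ L lo hi U k y) U) <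
      α₀ * (L : ℝ) ^ 2 * (((L : ℝ) ^ k)⁻¹) ^ 2 := by
    rw [pdevOn_gaugeAct huU]; exact h17
  exact ineq130_face_local hLs hL hd hG k _ hU' hα hα3 hα2 lo hi hlohi h17' h15' hsmall hmn hn x ν hx hxν hfl

end Local

/-! ## §4 The fine level: the closed form `(9d² + 4ds)·α₀·(L^{m+1}∕L^k)²` and `U₀″ = cutFixedZ …` -/

/-- ★ `8q·Σ_{i<m} qⁱ ≤ 9·qᵐ` for `q ≥ 9` (read at `q = L²`, `L ≥ 3`: `Σ_{i<m} L^{2i} = (L^{2m} − 1)∕(L² − 1)` and `8L² ≤ 9(L² − 1)`). [folklore] -/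
private theorem eight_mul_geom_le {q : ℝ} (hq : 9 ≤ q) :
    ∀ m : ℕ, 8 * q * ∑ i ∈ Finset.range m, q ^ i ≤ 9 * q ^ m
  | 0 => by simp
  | m + 1 => by
    have ih := eight_mul_geom_le hq m
    have hq0' : (0 : ℝ) ≤ q := by linarith
    have hq0 : (0 : ℝ) ≤ q ^ m := by positivity
    rw [Finset.sum_range_succ, mul_add, pow_succ]
    nlinarith [mul_le_mul_of_nonneg_left hq hq0]

/-- ★★ **THE CLOSED FORM OF THE FACE SUM AT THE FINE LEVEL**: with `a_n = 2α₀L²L^{−2n}`, `m + 1 ≤ k`, `L ≥ 3`: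
`Σ_{i<m} 4d²L²·a_{k−i} + 2ds·a_{k−m} ≤ (9d² + 4ds)·α₀·(L^{m+1})²·(L^k)^{−2}` (the hierarchical axial gauge jumps by `O(α₀L^{2(m+1−k)})` across a level-`m` face).
[cite: Balaban1985RegularSpaces, (1.130) p.99, p.87 (the geometric series of (1.65))] -/
theorem faceSum_aLev_le {L s : ℕ} (hLs : L = 2 * s + 1) (hs : 1 ≤ s) (d : ℕ) {α₀ : ℝ} (hα : 0 ≤ α₀) {k m : ℕ} (hmk : m + 1 ≤ k) :
    (∑ i ∈ Finset.range m, 4 * (d : ℝ) ^ 2 * (L : ℝ) ^ 2 * aLev α₀ L (k - i)) + 2 * ((d : ℝ) * s) * aLev α₀ L (k - m) ≤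
      (9 * (d : ℝ) ^ 2 + 4 * d * s) * α₀ * (((L : ℝ) ^ (m + 1)) ^ 2 * (((L : ℝ) ^ k)⁻¹) ^ 2) := by
  have h3L : 3 ≤ L := by omega
  have hL3 : (3 : ℝ) ≤ L := by exact_mod_cast h3L
  have hLpos : (0 : ℝ) < L := by linarith
  have hLne : (L : ℝ) ≠ 0 := hLpos.ne'
  have hq9 : (9 : ℝ) ≤ (L : ℝ) ^ 2 := by nlinarith
  -- `L^{−2(k−i)} = L^{2i}·L^{−2k}`
  have hsplit : ∀ i, i ≤ k → (((L : ℝ) ^ (k - i))⁻¹) ^ 2 = ((L : ℝ) ^ 2) ^ i * (((L : ℝ) ^ k)⁻¹) ^ 2 := fun i hi => by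
    have hk : (L : ℝ) ^ k = (L : ℝ) ^ i * (L : ℝ) ^ (k - i) := by rw [← pow_add, Nat.add_sub_cancel' hi]
    have hi0 : (L : ℝ) ^ i ≠ 0 := pow_ne_zero _ hLne
    have hki0 : (L : ℝ) ^ (k - i) ≠ 0 := pow_ne_zero _ hLne
    rw [hk, ← pow_mul]
    field_simp
    ring
  have hterm : ∀ i ∈ Finset.range m, 4 * (d : ℝ) ^ 2 * (L : ℝ) ^ 2 * aLev α₀ L (k - i) =
      ((d : ℝ) ^ 2 * α₀ * (((L : ℝ) ^ k)⁻¹) ^ 2 * (L : ℝ) ^ 2) * ((8 * (L : ℝ) ^ 2) * ((L : ℝ) ^ 2) ^ i) := fun i hi => by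
    have hi' := Finset.mem_range.mp hi
    unfold aLev
    rw [hsplit i (by omega)]
    ring
  rw [Finset.sum_congr rfl hterm, ← Finset.mul_sum, ← Finset.mul_sum]
  have hgeom := eight_mul_geom_le hq9 m
  have hlast : 2 * ((d : ℝ) * s) * aLev α₀ L (k - m) =
      4 * d * s * α₀ * (((L : ℝ) ^ k)⁻¹) ^ 2 * (L : ℝ) ^ 2 * ((L : ℝ) ^ 2) ^ m := by
    unfold aLev
    rw [hsplit m (by omega)]
    ring
  have hpow : ((L : ℝ) ^ (m + 1)) ^ 2 = (L : ℝ) ^ 2 * ((L : ℝ) ^ 2) ^ m := by ring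
  rw [hlast, hpow]
  have hc0 : 0 ≤ (d : ℝ) ^ 2 * α₀ * (((L : ℝ) ^ k)⁻¹) ^ 2 * (L : ℝ) ^ 2 := by positivity
  have hR : (9 * (d : ℝ) ^ 2 + 4 * d * s) * α₀ * ((L : ℝ) ^ 2 * ((L : ℝ) ^ 2) ^ m * (((L : ℝ) ^ k)⁻¹) ^ 2) =
      ((d : ℝ) ^ 2 * α₀ * (((L : ℝ) ^ k)⁻¹) ^ 2 * (L : ℝ) ^ 2) * (9 * ((L : ℝ) ^ 2) ^ m) +
        4 * d * s * α₀ * (((L : ℝ) ^ k)⁻¹) ^ 2 * (L : ℝ) ^ 2 * ((L : ℝ) ^ 2) ^ m := by ring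
  rw [hR]
  have := mul_le_mul_of_nonneg_left hgeom hc0
  linarith

section Fine

variable {𝔸 : Type*} [NormedRing 𝔸] [NormOneClass 𝔸] [NormedAlgebra ℂ 𝔸] [CompleteSpace 𝔸]

/-- ★★★ **THE FACE-LEVEL (1.133) FOR `U₀″ = cutFixedZ …` AT THE FINE BONDS** ([6] p. 99 «U₀″ equal to U₀′ on □̃»): `G` `AvgClosedZ`, odd `L = 2s+1 ≥ 3`, `d ≥ 1`, `U₀` `G`-valued with
(1.7) on the unit plaquettes of `□̃ = [tlo k, thi k]`, the Prop.-1 smallness and `11d²L²α₀ ≤ 1∕6`; then every fine bond `⟨x, x + e_ν⟩ ⊂ □̃` whose endpoints lie in ONE centred block of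
level `m + 1 ≤ k` (`flmZ L (m+1) x = flmZ L (m+1) (x + e_ν)`) obeys `|U₀″(x, x + e_ν) − 1| ≤ (9d² + 4ds)·α₀·(L^{m+1})²·(L^k)^{−2}` — for ANY centre `y` of the top gauge.
[cite: Balaban1985RegularSpaces, (1.133) p.99, (1.130) p.99, Lemma 1 p.79, (1.135) p.99; Balaban1985Averaging, (166)–(167) p.44; Balaban1987RG1, (0.4) p.253] -/
theorem norm_cutFixedZ_sub_one_le_face {L s : ℕ} (hLs : L = 2 * s + 1) (hs : 1 ≤ s) (hd : 1 ≤ d) {G : Subgroup 𝔸ˣ} (hG : AvgClosedZ d L G) (k : ℕ)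
    (U : Site d → Fin d → 𝔸ˣ) (hU : ∀ x κ, U x κ ∈ G) {α₀ : ℝ} (hα : 0 < α₀)
    (hα3 : C0Z d * (α₀ * (L : ℝ) ^ 2) ≤ 1 / 3) (hα2 : 2 * (α₀ * (L : ℝ) ^ 2) ≤ c2' d L)
    (lo hi : Site d) (hlohi : lo ≤ hi)
    (h17 : pdevOn (tlo L lo k) (thi L hi k) U < α₀ * (L : ℝ) ^ 2 * (((L : ℝ) ^ k)⁻¹) ^ 2)
    (hsmall : 11 * (d : ℝ) ^ 2 * (L : ℝ) ^ 2 * α₀ ≤ 1 / 6) (y : Site d)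
    {m : ℕ} (hmk : m + 1 ≤ k) (x : Site d) (ν : Fin d) (hx : tlo L lo k ≤ x) (hxν : x + e ν ≤ thi L hi k)
    (hfl : flmZ L (m + 1) x = flmZ L (m + 1) (x + e ν)) :
    ‖((cutFixedZ L lo hi U k y x ν : 𝔸ˣ) : 𝔸) - 1‖ ≤ (9 * (d : ℝ) ^ 2 + 4 * d * s) * α₀ * (((L : ℝ) ^ (m + 1)) ^ 2 * (((L : ℝ) ^ k)⁻¹) ^ 2) := by
  have hL : 2 ≤ L := by omega
  have hag : AgreeOn (tlo L lo k) (thi L hi k) (cutFixedZ L lo hi U k y) (gaugeAct (localGaugeZ L lo hi U k y) U) := cutCfg_agree _ _ _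
  have h := ineq130_face_fixed hLs hL hd hG k U hU hα hα3 hα2 lo hi hlohi h17 hsmall y hmk le_rfl x ν hx hxν hfl
  rw [← avgIterZ_eq_of_agree hLs hag le_rfl hx hxν, Nat.sub_self, avgIterZ_zero] at h
  exact h.trans (faceSum_aLev_le hLs hs d hα.le hmk)

end Fine

end Literature.MathematicalPhysics.QuantumFieldTheory.Balaban1983to89.B8Ineq130FaceRec

end

/-! ## Axiom audit (gate whitelist: `propext`, `Classical.choice`, `Quot.sound`) -/
#print axioms Literature.MathematicalPhysics.QuantumFieldTheory.Balaban1983to89.B8Ineq130FaceRec.descent_face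
#print axioms Literature.MathematicalPhysics.QuantumFieldTheory.Balaban1983to89.B8Ineq130FaceRec.norm_cutFixedZ_sub_one_le_face
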